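import Literature.NumberTheory.Automorphic.CuspidalCohomologyGL
import Literature.NumberTheory.Automorphic.CompletedCohomologyActionGL
import HarnessLib

/-!
# Change of level for twisted coefficients: `Fun(𝒢 ⧸ L, V)` as the `L/L'`-invariants of
# `Fun(𝒢 ⧸ L', V)`, and the compatibility of Hecke operators

Topic `NumberTheory/Automorphic`; namespace `Literature.NumberTheory.Automorphic`, grouping
sub-namespace `TwistedQuotient` (as `CuspidalCohomologyGL`).  Auxiliary definitions with bodies
and theorems; no named fact.

Setting of `TwistedQuotient` (`ι : Γ →* 𝒢`, `ρ : Γ → GL(V)`, twisted coefficients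
`Fun(𝒢 ⧸ L, V)`, `(γ f)(c) = ρ(γ) f(ι(γ)⁻¹ c)`) with TWO levels `L' ≤ L ≤ 𝒢` such that `L`
normalises `L'` (`[(L'.subgroupOf L).Normal]`), e.g. two members `U_r ≤ U` of the `p`-power
tower of a tame level.  We provide the change-of-level package behind the Hochschild–Serre
comparison of [Scholze2015, §V.4, proof of Thm. V.4.1] (`X_{K'} → X_K` "is a finite covering map
of degree `[K : K']`", Galois with group `K/K'` for `K' ◁ K`):

* `qsmul`: the (free, `levelQuot_free`) action of `L ⧸ L'` on `𝒢 ⧸ L'` by `[l] • xL' = x l⁻¹ L'`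
  (right translation, the tree's `ArithmeticQuotient.translateQuot`), commuting with the left
  `𝒢`-action (`qsmul_smul_comm`); `levelQuotAction` packages it as a `MulAction` (a `def`, to
  be installed with `letI`);
* `levelProdRep ι hle ρ`: the representation of `Γ × (L ⧸ L')` on `Fun(𝒢 ⧸ L', V)`,
  `((γ, h) f)(c) = ρ(γ) f(ι(γ)⁻¹ h⁻¹ c)`, whose restriction to `Γ` is the twisted coefficient
  representation of level `L'` (`levelProdRep_inl`) and to `L ⧸ L'` the (un-twisted in `V`)
  translation action (`levelProdRep_inr_apply`);
* `levelPullback`: `Fun(𝒢 ⧸ L, V) ⟶ Fun(𝒢 ⧸ L', V)` (pull-back along `𝒢 ⧸ L' → 𝒢 ⧸ L`), an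
  injective morphism of `Γ`-representations whose image is exactly the `L ⧸ L'`-invariant
  functions (`qsmul_levelPullback`, `levelDescend`, `levelPullback_levelDescend`):
  `Fun(𝒢 ⧸ L, V) = Fun(𝒢 ⧸ L', V)^{L/L'}`;
* Hecke operators: `[L' g₀ L']` commutes with the `L ⧸ L'`-action as soon as
  `l g₀ l⁻¹ ∈ L' g₀ L'` for `l ∈ L` (`heckeFun_comp_qsmul`, `heckeProdHom`, from the tree's
  `ArithmeticQuotient.heckeFun_comp_translateQuot`), and `[L' g₀ L'] ∘ pull-back =
  pull-back ∘ [L g₀ L]` as soon as `L' g₀ L'/L' → L g₀ L/L` is a bijection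
  (`heckeFun_levelPullback`, `heckeRepHom_comp_levelPullback`; the bijection for the tame tower
  and the spherical `t_{w,i}` is the tree's `BigHeckeGLn.TameLevel.bijOn_tower_heckeElement_conj`).

With `Literature/Algebra/Homology/GroupCohomologyInvariantsNilpotent{,Holds}` this gives: a
polynomial in such Hecke operators vanishing on `Hᵇ(Γ, Fun(𝒢 ⧸ L', V))` for `b ≤ q` acts on
`H^q(Γ, Fun(𝒢 ⧸ L, V))` with `(q+1)`-st power zero (assembled elsewhere).

## References

* P. Scholze, *On torsion in the cohomology of locally symmetric varieties*, Ann. of Math. 182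
  (2015), §V.4, before Thm. V.4.1 and proof of Thm. V.4.1 [Scholze2015].
* G. Shimura, *Introduction to the arithmetic theory of automorphic functions* (1971), Ch. 3,
  Prop. 3.1 [ShimuraIATAF1971].
-/

noncomputable section

open CategoryTheory

universe u

namespace Literature.NumberTheory.Automorphic

namespace TwistedQuotient

/-! ### The action of `L ⧸ L'` on `𝒢 ⧸ L'` by right translation -/

section QuotAction

variable {𝒢 : Type u} [Group 𝒢] {L' L : Subgroup 𝒢} (hle : L' ≤ L) [hN : (L'.subgroupOf L).Normal]

include hle in
/-- `L` normalises `L'`: `l a l⁻¹ ∈ L'` for `l ∈ L`, `a ∈ L'`. [folklore] -/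
theorem conj_mem_of_normal_subgroupOf (l : L) {a : 𝒢} (ha : a ∈ L') :
    (l : 𝒢) * a * (l : 𝒢)⁻¹ ∈ L' := by
  have h := hN.conj_mem ⟨a, hle ha⟩ (Subgroup.mem_subgroupOf.2 ha) l
  rw [Subgroup.mem_subgroupOf] at h
  exact h

include hle in
/-- `(l⁻¹)⁻¹ L' l⁻¹ ⊆ L'` (`ConjInto`), so that right translation by `l⁻¹` is defined on `𝒢 ⧸ L'`.
[folklore] -/
theorem conjInto_inv (l : L) : ArithmeticQuotient.ConjInto ((l : 𝒢)⁻¹) L' L' := fun a ha => by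
  rw [inv_inv]
  exact conj_mem_of_normal_subgroupOf hle l ha

/-- Right translation by `l⁻¹`: `xL' ↦ x l⁻¹ L'`, for `l ∈ L`. [folklore] -/
def lsmul (l : L) : 𝒢 ⧸ L' → 𝒢 ⧸ L' :=
  ArithmeticQuotient.translateQuot ((l : 𝒢)⁻¹) (conjInto_inv hle l)

/-- `lsmul l (xL') = x l⁻¹ L'`. [folklore] -/
@[simp]
theorem lsmul_mk (l : L) (x : 𝒢) : lsmul hle l (x : 𝒢 ⧸ L') = ((x * (l : 𝒢)⁻¹ : 𝒢) : 𝒢 ⧸ L') :=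
  rfl

/-- `lsmul 1 = id`. [folklore] -/
theorem lsmul_one (c : 𝒢 ⧸ L') : lsmul hle 1 c = c := by
  induction c using QuotientGroup.induction_on with
  | H x => rw [lsmul_mk, OneMemClass.coe_one, inv_one, mul_one]

/-- `lsmul (l₁ l₂) = lsmul l₁ ∘ lsmul l₂`. [folklore] -/
theorem lsmul_mul (l₁ l₂ : L) (c : 𝒢 ⧸ L') :
    lsmul hle (l₁ * l₂) c = lsmul hle l₁ (lsmul hle l₂ c) := by
  induction c using QuotientGroup.induction_on with
  | H x => simp only [lsmul_mk, Subgroup.coe_mul, mul_inv_rev, mul_assoc]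

/-- Elements of `L'` act trivially. [folklore] -/
theorem lsmul_of_mem {l : L} (hl : (l : 𝒢) ∈ L') (c : 𝒢 ⧸ L') : lsmul hle l c = c := by
  induction c using QuotientGroup.induction_on with
  | H x =>
    rw [lsmul_mk]
    refine QuotientGroup.eq.2 ?_
    rw [mul_inv_rev, inv_inv, mul_assoc, inv_mul_cancel, mul_one]
    exact hl

/-- **The action of `L ⧸ L'` on `𝒢 ⧸ L'`**: `[l] • xL' = x l⁻¹ L'`. [folklore] -/
def qsmul (h : L ⧸ L'.subgroupOf L) (c : 𝒢 ⧸ L') : 𝒢 ⧸ L' :=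
  Quotient.liftOn' h (fun l => lsmul hle l c) fun a b hab => by
    have hab' : ((a⁻¹ * b : L) : 𝒢) ∈ L' :=
      Subgroup.mem_subgroupOf.1 (QuotientGroup.leftRel_apply.1 hab)
    change lsmul hle a c = lsmul hle b c
    have hb : b = a * (a⁻¹ * b) := by rw [mul_inv_cancel_left]
    rw [hb, lsmul_mul, lsmul_of_mem hle hab']

/-- `qsmul [l] c = lsmul l c`. [folklore] -/
@[simp]
theorem qsmul_mk (l : L) (c : 𝒢 ⧸ L') :
    qsmul hle (l : L ⧸ L'.subgroupOf L) c = lsmul hle l c :=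
  rfl

/-- `qsmul 1 = id`. [folklore] -/
theorem qsmul_one (c : 𝒢 ⧸ L') : qsmul hle 1 c = c := by
  rw [← QuotientGroup.mk_one, qsmul_mk, lsmul_one]

/-- `qsmul (h₁ h₂) = qsmul h₁ ∘ qsmul h₂`. [folklore] -/
theorem qsmul_mul (h₁ h₂ : L ⧸ L'.subgroupOf L) (c : 𝒢 ⧸ L') :
    qsmul hle (h₁ * h₂) c = qsmul hle h₁ (qsmul hle h₂ c) := by
  induction h₁ using QuotientGroup.induction_on with
  | H l₁ =>
    induction h₂ using QuotientGroup.induction_on with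
    | H l₂ => rw [← QuotientGroup.mk_mul, qsmul_mk, qsmul_mk, qsmul_mk, lsmul_mul]

/-- `L ⧸ L'` acts on `𝒢 ⧸ L'` (a `def`; install with `letI := levelQuotAction hle`). [folklore] -/
@[reducible]
def levelQuotAction : MulAction (L ⧸ L'.subgroupOf L) (𝒢 ⧸ L') where
  smul := qsmul hle
  one_smul := qsmul_one hle
  mul_smul := qsmul_mul hle

/-- The action commutes with the left `𝒢`-action: `h • (g • c) = g • (h • c)`. [folklore] -/
theorem qsmul_smul_comm (h : L ⧸ L'.subgroupOf L) (g : 𝒢) (c : 𝒢 ⧸ L') :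
    qsmul hle h (g • c) = g • qsmul hle h c := by
  induction h using QuotientGroup.induction_on with
  | H l => exact ArithmeticQuotient.translateQuot_smul ((l : 𝒢)⁻¹) (conjInto_inv hle l) g c

/-- **The action of `L ⧸ L'` on `𝒢 ⧸ L'` is free.** [folklore] -/
theorem levelQuot_free (h : L ⧸ L'.subgroupOf L) (c : 𝒢 ⧸ L') (hc : qsmul hle h c = c) :
    h = 1 := by
  induction h using QuotientGroup.induction_on with
  | H l =>
    induction c using QuotientGroup.induction_on with
    | H x =>
      rw [qsmul_mk, lsmul_mk, QuotientGroup.eq, mul_inv_rev, inv_inv, mul_assoc,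
        inv_mul_cancel, mul_one] at hc
      rw [QuotientGroup.eq_one_iff, Subgroup.mem_subgroupOf]
      exact hc

end QuotAction

/-! ### Pull-back `Fun(𝒢 ⧸ L, V) ↪ Fun(𝒢 ⧸ L', V)` and Hecke operators -/

section Pullback

variable {k : Type u} [CommRing k] {Γ 𝒢 : Type u} [Group Γ] [Group 𝒢]
variable (ι : Γ →* 𝒢) {L' L : Subgroup 𝒢} (hle : L' ≤ L)
variable {V : Type u} [AddCommGroup V] [Module k V] (ρ : Representation k Γ V)

/-- **Pull-back of twisted coefficients along `𝒢 ⧸ L' → 𝒢 ⧸ L`**, a morphism of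
`Γ`-representations `Fun(𝒢 ⧸ L, V) ⟶ Fun(𝒢 ⧸ L', V)` (the pull-back of sections of the local
system along the covering `X_{L'} → X_L`). [folklore] -/
def levelPullback : coeffRep ι L ρ ⟶ coeffRep ι L' ρ :=
  Rep.ofHom ⟨LinearMap.funLeft k V (Subgroup.quotientMapOfLE hle), fun γ =>
    LinearMap.ext fun f => funext fun c => by
      simp [ArithmeticQuotient.quotientMapOfLE_smul]⟩

/-- Unfolding lemma for `levelPullback`. [folklore] -/
@[simp]
theorem levelPullback_hom_apply (f : (𝒢 ⧸ L) → V) (c : 𝒢 ⧸ L') :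
    (levelPullback ι hle ρ).hom f c = f (Subgroup.quotientMapOfLE hle c) :=
  rfl

/-- `levelPullback` is injective (`𝒢 ⧸ L' → 𝒢 ⧸ L` is surjective). [folklore] -/
theorem levelPullback_injective : Function.Injective (levelPullback ι hle ρ).hom := by
  intro f g hfg
  funext c
  induction c using QuotientGroup.induction_on with
  | H x =>
    have h := congrFun hfg (x : 𝒢 ⧸ L')
    rwa [levelPullback_hom_apply, levelPullback_hom_apply,
      Subgroup.quotientMapOfLE_apply_mk] at h

/-- **Hecke operators commute with pull-back**: `[L' g₀ L'] (f ∘ π) = ([L g₀ L] f) ∘ π` for the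
projection `π : 𝒢 ⧸ L' → 𝒢 ⧸ L`, as soon as `π` maps `L' g₀ L' / L'` bijectively onto
`L g₀ L / L` (finite).  For the tame tower and `t_{w,i}`, `w ∉ S`, the bijection is the tree's
`BigHeckeGLn.TameLevel.bijOn_tower_heckeElement_conj` (with `g = 1`).
[cite: ShimuraIATAF1971, Ch. 3, Prop. 3.1] -/
theorem heckeFun_levelPullback {g₀ : 𝒢}
    (hbij : Set.BijOn (fun c => (1 : 𝒢)⁻¹ • ArithmeticQuotient.translateQuot (1 : 𝒢)
        (ArithmeticQuotient.conjInto_one_iff.2 hle) c)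
      (ArithmeticQuotient.doubleCosetQuot L' g₀) (ArithmeticQuotient.doubleCosetQuot L g₀))
    (hfin : (ArithmeticQuotient.doubleCosetQuot L g₀).Finite) (f : (𝒢 ⧸ L) → V) :
    ArithmeticQuotient.heckeFun k L' g₀ V ((levelPullback ι hle ρ).hom f) =
      (levelPullback ι hle ρ).hom (ArithmeticQuotient.heckeFun k L g₀ V f) := by
  have hpull : ∀ F : (𝒢 ⧸ L) → V, (levelPullback ι hle ρ).hom F =
      F ∘ ArithmeticQuotient.translateQuot (1 : 𝒢) (ArithmeticQuotient.conjInto_one_iff.2 hle) :=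
    fun F => funext fun c => by
      rw [levelPullback_hom_apply, Function.comp_apply,
        ArithmeticQuotient.translateQuot_one _ hle]
  rw [hpull, hpull]
  exact ArithmeticQuotient.heckeFun_comp_translateQuot (k := k) _ hbij hfin f

/-- `heckeFun_levelPullback` for morphisms of `Γ`-representations:
`T^L_{g₀} ≫ pull-back = pull-back ≫ T^{L'}_{g₀}`. [folklore] -/
theorem heckeRepHom_comp_levelPullback {g₀ : 𝒢}
    (hbij : Set.BijOn (fun c => (1 : 𝒢)⁻¹ • ArithmeticQuotient.translateQuot (1 : 𝒢)
        (ArithmeticQuotient.conjInto_one_iff.2 hle) c)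
      (ArithmeticQuotient.doubleCosetQuot L' g₀) (ArithmeticQuotient.doubleCosetQuot L g₀))
    (hfin : (ArithmeticQuotient.doubleCosetQuot L g₀).Finite) :
    heckeRepHom ι L ρ g₀ ≫ levelPullback ι hle ρ = levelPullback ι hle ρ ≫ heckeRepHom ι L' ρ g₀ :=
  Rep.hom_ext (Representation.IntertwiningMap.ext (LinearMap.ext fun f =>
    (heckeFun_levelPullback ι hle ρ hbij hfin f).symm))

end Pullback

/-! ### `Fun(𝒢 ⧸ L', V)` as a representation of `Γ × (L ⧸ L')` -/

section ProdRep

variable {k : Type u} [CommRing k] {Γ 𝒢 : Type u} [Group Γ] [Group 𝒢]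
variable (ι : Γ →* 𝒢) {L' L : Subgroup 𝒢} (hle : L' ≤ L) [hN : (L'.subgroupOf L).Normal]
variable {V : Type u} [AddCommGroup V] [Module k V] (ρ : Representation k Γ V)

/-- **`Fun(𝒢 ⧸ L', V)` as a representation of `Γ × (L ⧸ L')`**:
`((γ, h) f)(c) = ρ(γ) f(ι(γ)⁻¹ h⁻¹ c)` — twisted coefficients of level `L'` for `Γ`, right
translation for the Galois group `L ⧸ L'` of `X_{L'} → X_L`
[cite: Scholze2015, §V.4, before Thm. V.4.1]. -/
def levelProdRep : Representation k (Γ × (L ⧸ L'.subgroupOf L)) ((𝒢 ⧸ L') → V) where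
  toFun p := (ρ p.1).compLeft (𝒢 ⧸ L') ∘ₗ
    LinearMap.funLeft k V fun c : 𝒢 ⧸ L' => (ι p.1)⁻¹ • qsmul hle p.2⁻¹ c
  map_one' := by
    refine LinearMap.ext fun f => funext fun c => ?_
    simp [qsmul_one]
  map_mul' p p' := by
    refine LinearMap.ext fun f => funext fun c => ?_
    simp only [Prod.fst_mul, Prod.snd_mul, map_mul, mul_inv_rev, LinearMap.coe_comp,
      Function.comp_apply, LinearMap.funLeft_apply, LinearMap.compLeft_apply,
      Module.End.mul_apply]
    rw [mul_smul, qsmul_mul, qsmul_smul_comm]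

/-- Unfolding lemma for `levelProdRep`. [folklore] -/
@[simp]
theorem levelProdRep_apply (p : Γ × (L ⧸ L'.subgroupOf L)) (f : (𝒢 ⧸ L') → V) (c : 𝒢 ⧸ L') :
    levelProdRep ι hle ρ p f c = ρ p.1 (f ((ι p.1)⁻¹ • qsmul hle p.2⁻¹ c)) :=
  rfl

/-- Restricted to `Γ`, `levelProdRep` is the twisted coefficient representation of level `L'`.
[folklore] -/
theorem levelProdRep_inl (γ : Γ) :
    levelProdRep ι hle ρ (MonoidHom.inl _ _ γ) = coeffRepresentation ι L' ρ γ := by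
  refine LinearMap.ext fun f => funext fun c => ?_
  rw [levelProdRep_apply, coeffRepresentation_apply, MonoidHom.inl_apply]
  simp only [inv_one, qsmul_one]

/-- Restricted to `L ⧸ L'`, `levelProdRep` is the translation action: `(h f)(c) = f(h⁻¹ c)`.
[folklore] -/
theorem levelProdRep_inr_apply (h : L ⧸ L'.subgroupOf L) (f : (𝒢 ⧸ L') → V) (c : 𝒢 ⧸ L') :
    levelProdRep ι hle ρ (MonoidHom.inr _ _ h) f c = f (qsmul hle h⁻¹ c) := by
  rw [levelProdRep_apply, MonoidHom.inr_apply]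
  simp only [map_one, inv_one, one_smul, Module.End.one_apply]

/-! ### Descent of `L ⧸ L'`-invariant functions to `𝒢 ⧸ L` -/

/-- The projection `𝒢 ⧸ L' → 𝒢 ⧸ L` is constant on `L ⧸ L'`-orbits. [folklore] -/
theorem quotientMapOfLE_qsmul (h : L ⧸ L'.subgroupOf L) (c : 𝒢 ⧸ L') :
    Subgroup.quotientMapOfLE hle (qsmul hle h c) = Subgroup.quotientMapOfLE hle c := by
  induction h using QuotientGroup.induction_on with
  | H l =>
    induction c using QuotientGroup.induction_on with
    | H x =>
      rw [qsmul_mk, lsmul_mk, Subgroup.quotientMapOfLE_apply_mk,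
        Subgroup.quotientMapOfLE_apply_mk]
      exact QuotientGroup.eq.2 (by simp)

/-- Pulled-back functions are `L ⧸ L'`-invariant. [folklore] -/
theorem qsmul_levelPullback (f : (𝒢 ⧸ L) → V) (h : L ⧸ L'.subgroupOf L) (c : 𝒢 ⧸ L') :
    (levelPullback ι hle ρ).hom f (qsmul hle h c) = (levelPullback ι hle ρ).hom f c := by
  rw [levelPullback_hom_apply, levelPullback_hom_apply, quotientMapOfLE_qsmul]

/-- **Descent of an `L ⧸ L'`-invariant function on `𝒢 ⧸ L'` to `𝒢 ⧸ L`.** [folklore] -/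
def levelDescend (f : (𝒢 ⧸ L') → V)
    (hf : ∀ (h : L ⧸ L'.subgroupOf L) (c : 𝒢 ⧸ L'), f (qsmul hle h c) = f c) : (𝒢 ⧸ L) → V :=
  Quotient.lift (fun x : 𝒢 => f (x : 𝒢 ⧸ L')) fun x y hxy => by
    have hxy' : x⁻¹ * y ∈ L := QuotientGroup.leftRel_apply.1 hxy
    have h := hf ((⟨x⁻¹ * y, hxy'⟩ : L) : L ⧸ L'.subgroupOf L) (y : 𝒢 ⧸ L')
    rw [qsmul_mk, lsmul_mk] at h
    rw [← h, Subgroup.coe_mk, mul_inv_rev, inv_inv, mul_inv_cancel_left]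

omit [AddCommGroup V] [Module k V] in
/-- `levelDescend f (xL) = f (xL')`. [folklore] -/
@[simp]
theorem levelDescend_mk (f : (𝒢 ⧸ L') → V)
    (hf : ∀ (h : L ⧸ L'.subgroupOf L) (c : 𝒢 ⧸ L'), f (qsmul hle h c) = f c) (x : 𝒢) :
    levelDescend hle f hf (x : 𝒢 ⧸ L) = f (x : 𝒢 ⧸ L') :=
  rfl

/-- Pulling back the descent recovers the invariant function. [folklore] -/
theorem levelPullback_levelDescend (f : (𝒢 ⧸ L') → V)
    (hf : ∀ (h : L ⧸ L'.subgroupOf L) (c : 𝒢 ⧸ L'), f (qsmul hle h c) = f c) :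
    (levelPullback ι hle ρ).hom (levelDescend hle f hf) = f := by
  funext c
  induction c using QuotientGroup.induction_on with
  | H x => rw [levelPullback_hom_apply, Subgroup.quotientMapOfLE_apply_mk, levelDescend_mk]

/-- Descending a pulled-back function recovers it. [folklore] -/
theorem levelDescend_levelPullback (g : (𝒢 ⧸ L) → V)
    (hf : ∀ (h : L ⧸ L'.subgroupOf L) (c : 𝒢 ⧸ L'),
      (levelPullback ι hle ρ).hom g (qsmul hle h c) = (levelPullback ι hle ρ).hom g c) :
    levelDescend hle ((levelPullback ι hle ρ).hom g) hf = g := by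
  funext c
  induction c using QuotientGroup.induction_on with
  | H x => rw [levelDescend_mk, levelPullback_hom_apply, Subgroup.quotientMapOfLE_apply_mk]

/-! ### Hecke operators commute with the `L ⧸ L'`-action -/

omit hN in
/-- Conjugation by `m` maps `L' g₀ L' / L'` into itself when `m` normalises `L'` and
`m g₀ m⁻¹ ∈ L' g₀ L'`: `m (a g₀) m⁻¹ L' = (m a m⁻¹) a₁ g₀ b₁ L'`. [folklore] -/
theorem mapsTo_doubleCosetQuot_conj {g₀ m : 𝒢} (hm : ∀ a ∈ L', m * a * m⁻¹ ∈ L')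
    (hg : ∃ a ∈ L', ∃ b ∈ L', m * g₀ * m⁻¹ = a * g₀ * b)
    (h : ArithmeticQuotient.ConjInto m⁻¹ L' L') :
    Set.MapsTo (fun c => (m⁻¹)⁻¹ • ArithmeticQuotient.translateQuot m⁻¹ h c)
      (ArithmeticQuotient.doubleCosetQuot L' g₀) (ArithmeticQuotient.doubleCosetQuot L' g₀) := by
  rintro _ ⟨a, rfl⟩
  obtain ⟨a₁, ha₁, b₁, hb₁, he⟩ := hg
  refine ⟨⟨m * a * m⁻¹ * a₁, L'.mul_mem (hm a a.2) ha₁⟩, ?_⟩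
  change ((m * a * m⁻¹ * a₁ : 𝒢) • (g₀ : 𝒢 ⧸ L')) =
    (m⁻¹)⁻¹ • ArithmeticQuotient.translateQuot m⁻¹ h ((a : 𝒢) • (g₀ : 𝒢 ⧸ L'))
  rw [MulAction.Quotient.smul_coe, MulAction.Quotient.smul_coe, smul_eq_mul, smul_eq_mul,
    ArithmeticQuotient.translateQuot_mk, MulAction.Quotient.smul_coe, smul_eq_mul, inv_inv,
    QuotientGroup.eq]
  have : (m * ↑a * m⁻¹ * a₁ * g₀)⁻¹ * (m * (↑a * g₀ * m⁻¹)) = b₁ := by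
    calc (m * ↑a * m⁻¹ * a₁ * g₀)⁻¹ * (m * (↑a * g₀ * m⁻¹))
        = g₀⁻¹ * a₁⁻¹ * (m * g₀ * m⁻¹) := by group
      _ = b₁ := by rw [he]; group
  rw [this]
  exact hb₁

omit hN in
/-- **Conjugation by an element `m` normalising `L'` with `m^{±1} g₀ m^{∓1} ∈ L' g₀ L'` permutes
`L' g₀ L' / L'`** (stated for the map `c ↦ m c m⁻¹` in the form used by
`ArithmeticQuotient.heckeFun_comp_translateQuot`). [folklore] -/
theorem bijOn_doubleCosetQuot_conj_of_normalizes {g₀ m : 𝒢}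
    (hm : ∀ a ∈ L', m * a * m⁻¹ ∈ L') (hm' : ∀ a ∈ L', m⁻¹ * a * m ∈ L')
    (hg : ∃ a ∈ L', ∃ b ∈ L', m * g₀ * m⁻¹ = a * g₀ * b)
    (hg' : ∃ a ∈ L', ∃ b ∈ L', m⁻¹ * g₀ * m = a * g₀ * b)
    (h : ArithmeticQuotient.ConjInto m⁻¹ L' L') :
    Set.BijOn (fun c => (m⁻¹)⁻¹ • ArithmeticQuotient.translateQuot m⁻¹ h c)
      (ArithmeticQuotient.doubleCosetQuot L' g₀) (ArithmeticQuotient.doubleCosetQuot L' g₀) := by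
  have h' : ArithmeticQuotient.ConjInto m⁻¹⁻¹ L' L' := fun a ha => by
    simpa only [inv_inv] using hm' a ha
  have hg'' : ∃ a ∈ L', ∃ b ∈ L', m⁻¹ * g₀ * m⁻¹⁻¹ = a * g₀ * b := by
    simpa only [inv_inv] using hg'
  have hm'' : ∀ a ∈ L', m⁻¹ * a * m⁻¹⁻¹ ∈ L' := fun a ha => by
    simpa only [inv_inv] using hm' a ha
  refine Set.InvOn.bijOn (f' := fun c => (m⁻¹⁻¹)⁻¹ • ArithmeticQuotient.translateQuot m⁻¹⁻¹ h' c)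
    ⟨fun c _ => ?_, fun c _ => ?_⟩ (mapsTo_doubleCosetQuot_conj hm hg h)
    (mapsTo_doubleCosetQuot_conj hm'' hg'' h')
  all_goals
    induction c using QuotientGroup.induction_on with
    | H x =>
      simp only [ArithmeticQuotient.translateQuot_mk, MulAction.Quotient.smul_coe, smul_eq_mul,
        inv_inv]
      refine QuotientGroup.eq.2 ?_
      simp [mul_assoc]

/-- **The Hecke operator `[L' g₀ L']` commutes with the `L ⧸ L'`-action** (right translations by
`l ∈ L`) as soon as `l g₀ l⁻¹ ∈ L' g₀ L'` for all `l ∈ L` (for the tame tower and the spherical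
`t_{w,i}`, `w ∉ S`: `u t u⁻¹ = ι_w(u_w t u_w⁻¹) ∈ U_r t U_r`). [cite: ShimuraIATAF1971, Ch. 3, Prop. 3.1] -/
theorem heckeFun_comp_lsmul {g₀ : 𝒢}
    (hconj : ∀ l : L, ∃ a ∈ L', ∃ b ∈ L', (l : 𝒢) * g₀ * (l : 𝒢)⁻¹ = a * g₀ * b)
    (hfin : (ArithmeticQuotient.doubleCosetQuot L' g₀).Finite) (l : L) (f : (𝒢 ⧸ L') → V) :
    ArithmeticQuotient.heckeFun k L' g₀ V (f ∘ lsmul hle l) =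
      ArithmeticQuotient.heckeFun k L' g₀ V f ∘ lsmul hle l := by
  have hl' := hconj l⁻¹
  simp only [Subgroup.coe_inv, inv_inv] at hl'
  exact ArithmeticQuotient.heckeFun_comp_translateQuot (k := k) (conjInto_inv hle l)
    (bijOn_doubleCosetQuot_conj_of_normalizes (fun a ha => conj_mem_of_normal_subgroupOf hle l ha)
      (fun a ha => by simpa using conj_mem_of_normal_subgroupOf hle l⁻¹ ha) (hconj l) hl'
      (conjInto_inv hle l)) hfin f

/-- `[L' g₀ L']` commutes with `qsmul`. [folklore] -/
theorem heckeFun_comp_qsmul {g₀ : 𝒢}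
    (hconj : ∀ l : L, ∃ a ∈ L', ∃ b ∈ L', (l : 𝒢) * g₀ * (l : 𝒢)⁻¹ = a * g₀ * b)
    (hfin : (ArithmeticQuotient.doubleCosetQuot L' g₀).Finite) (h : L ⧸ L'.subgroupOf L)
    (f : (𝒢 ⧸ L') → V) :
    ArithmeticQuotient.heckeFun k L' g₀ V (f ∘ qsmul hle h) =
      ArithmeticQuotient.heckeFun k L' g₀ V f ∘ qsmul hle h := by
  induction h using QuotientGroup.induction_on with
  | H l => exact heckeFun_comp_lsmul hle hconj hfin l f

/-- **`[L' g₀ L']` as an endomorphism of the `Γ × (L ⧸ L')`-representation `Fun(𝒢 ⧸ L', V)`**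
(it commutes with the twisted `Γ`-action, `heckeFun_coeffRepresentation`, and with the
translations, `heckeFun_comp_qsmul`). [folklore] -/
def heckeProdHom {g₀ : 𝒢}
    (hconj : ∀ l : L, ∃ a ∈ L', ∃ b ∈ L', (l : 𝒢) * g₀ * (l : 𝒢)⁻¹ = a * g₀ * b)
    (hfin : (ArithmeticQuotient.doubleCosetQuot L' g₀).Finite) :
    Rep.of (levelProdRep ι hle ρ) ⟶ Rep.of (levelProdRep ι hle ρ) :=
  Rep.ofHom (LinearMap.intertwiningMap_of_isIntertwiningMap _ _
    (ArithmeticQuotient.heckeFun k L' g₀ V) fun p f => by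
      have hdec' : ∀ F : (𝒢 ⧸ L') → V, levelProdRep ι hle ρ p F =
          coeffRepresentation ι L' ρ p.1 (F ∘ qsmul hle p.2⁻¹) := fun F => by
        funext c
        rw [levelProdRep_apply, coeffRepresentation_apply, Function.comp_apply, qsmul_smul_comm]
      rw [hdec' f, hdec', heckeFun_coeffRepresentation, heckeFun_comp_qsmul hle hconj hfin])

/-- Unfolding lemma for `heckeProdHom`. [folklore] -/
@[simp]
theorem heckeProdHom_hom_apply {g₀ : 𝒢}
    (hconj : ∀ l : L, ∃ a ∈ L', ∃ b ∈ L', (l : 𝒢) * g₀ * (l : 𝒢)⁻¹ = a * g₀ * b)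
    (hfin : (ArithmeticQuotient.doubleCosetQuot L' g₀).Finite) (f : (𝒢 ⧸ L') → V) :
    (heckeProdHom ι hle ρ hconj hfin).hom f = ArithmeticQuotient.heckeFun k L' g₀ V f :=
  rfl

end ProdRep

end TwistedQuotient

end Literature.NumberTheory.Automorphic
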